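import Literature.MathematicalPhysics.QuantumFieldTheory.ConstructiveQFTWave0Proofs
import Literature.MathematicalPhysics.QuantumFieldTheory.LatticeGaugeProofs
import Literature.MathematicalPhysics.QuantumLattice.LatticeGaugeDLR
import HarnessLib

/-!
# Convexity of the torus free energy in `β` and monotonicity of the mean Wilson action

Finite-volume Wilson lattice gauge theory on the discrete torus `(ℤ/Lℤ)^d` with an arbitrary
compact gauge group `G` and a continuous matrix representation `ρ` (tree objects `wilsonMeasure`,
`wilsonExpectation`, `partitionFunction`, `wilsonAction` of `ConstructiveQFTWave0`, and
`torusLogPartition d ρ β L = log Z_{Λ_L, β}` of `LatticeGaugeDLR`). Everything here is the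
derivative-free form of the thermodynamic identities `(log Z)' = -⟨S⟩`, `(log Z)'' = Var S ≥ 0`
(Jensen's inequality for `exp` under the Wilson measure):

* `wilsonExpectation_eq_integral_div` — Wilson expectations as Gibbs averages against product Haar
  measure, `⟨X⟩_β = ∫ X e^{-βS} / ∫ e^{-βS}`, with NO countability assumption on `G`
  (measurability of the action for the product σ-algebra comes from
  `WilsonRP.measurable_wilsonAction`);
* `mul_wilsonExpectation_wilsonAction_le` — the **supporting-line (Gibbs–Jensen) inequality**
  `(β - β') ⟨S⟩_β ≤ log Z(β') - log Z(β)` for all real `β, β'`;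
* `wilsonExpectation_wilsonAction_antitone` — the mean action `β ↦ ⟨S⟩_β` is non-increasing on `ℝ`;
* `convexOn_torusLogPartition` — `β ↦ log Z(β)` is convex on `ℝ`;
* `exp_mul_measureReal_le_integral_exp`, `wilsonExpectation_wilsonAction_le_laplace` — the
  weak-coupling (Laplace) bound: for `β > 0`, `ε > 0` and `Re tr ρ ≤ N` (so `S ≥ 0`),
  `Z(β) ≥ e^{-βε} · Haar^{⊗E}{S ≤ ε}` and `⟨S⟩_β ≤ 2ε - (2/β) log Haar^{⊗E}{S ≤ ε}`, the small-ball
  function of the action under product Haar measure being positive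
  (`measureReal_wilsonAction_le_pos`). With a polynomial small-ball lower bound
  `Haar^{⊗E}{S ≤ ε} ≥ c ε^k` this gives `⟨S⟩_β = O(log β / β)`.

## References

Folklore (convexity of the pressure / free energy in the coupling; e.g. S. Friedli, Y. Velenik,
*Statistical Mechanics of Lattice Systems*, CUP 2017, §3.2 and Appendix B.8 on Jensen's
inequality; E. Seiler, LNP 159 (1982), Ch. 2 for the lattice gauge setting). Everything is proved
from Mathlib (`ConvexOn.map_integral_le`) and the tree.
-/

noncomputable section

open MeasureTheory
open Literature.MathematicalPhysics.QuantumLattice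

namespace Literature.MathematicalPhysics.QuantumFieldTheory

variable {d L N : ℕ} {G : Type*} [Group G] [TopologicalSpace G] [IsTopologicalGroup G]
  [CompactSpace G] [MeasurableSpace G] [BorelSpace G] (ρ : G →* Matrix (Fin N) (Fin N) ℂ)

/-! ### Integrability of the Boltzmann factors -/

/-- `U ↦ exp(c · S(U))` is integrable for every finite measure on the configurations of a finite
torus (bounded and measurable for the product σ-algebra; continuous `ρ`). [folklore] -/
theorem integrable_exp_mul_wilsonAction [NeZero L] (hρ : Continuous ρ) (c : ℝ)
    (μ : Measure (GaugeConfig d L G)) [IsFiniteMeasure μ] :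
    Integrable (fun U => Real.exp (c * wilsonAction ρ U)) μ := by
  obtain ⟨B, hB⟩ := exists_abs_wilsonAction_le (d := d) (L := L) ρ hρ
  refine Integrable.of_bound (C := Real.exp (|c| * B)) ?_ (ae_of_all _ fun U => ?_)
  · exact (Real.measurable_exp.comp
      ((WilsonRP.measurable_wilsonAction ρ hρ).const_mul c)).aestronglyMeasurable
  · rw [Real.norm_eq_abs, Real.abs_exp]
    refine Real.exp_le_exp.2 ?_
    calc c * wilsonAction ρ U ≤ |c * wilsonAction ρ U| := le_abs_self _
      _ = |c| * |wilsonAction ρ U| := abs_mul _ _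
      _ ≤ |c| * B := mul_le_mul_of_nonneg_left (hB U) (abs_nonneg _)

/-- The Wilson action is integrable for every finite measure on the configurations of a finite
torus (continuous `ρ`). [folklore] -/
theorem integrable_wilsonAction [NeZero L] (hρ : Continuous ρ)
    (μ : Measure (GaugeConfig d L G)) [IsFiniteMeasure μ] :
    Integrable (wilsonAction (d := d) (L := L) ρ) μ := by
  obtain ⟨B, hB⟩ := exists_abs_wilsonAction_le (d := d) (L := L) ρ hρ
  exact Integrable.of_bound (WilsonRP.measurable_wilsonAction ρ hρ).aestronglyMeasurable B
    (ae_of_all _ fun U => by rw [Real.norm_eq_abs]; exact hB U)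

/-! ### The partition function and Wilson expectations as product-Haar integrals -/

/-- `Z_{Λ,β} = ∫ e^{-β S} dHaar^{⊗E}` as a real number (continuous `ρ`). [folklore] -/
theorem partitionFunction_toReal_eq_integral [NeZero L] (hρ : Continuous ρ) (β : ℝ) :
    (partitionFunction (d := d) (L := L) ρ β).toReal =
      ∫ U, Real.exp (-β * wilsonAction ρ U) ∂(Measure.pi fun _ : Edge d L => haarProbability G) := by
  have hZ : partitionFunction (d := d) (L := L) ρ β =
      ∫⁻ U, ENNReal.ofReal (Real.exp (-β * wilsonAction ρ U))
        ∂(Measure.pi fun _ : Edge d L => haarProbability G) := by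
    simp only [partitionFunction, wilsonWeight, withDensity_apply _ MeasurableSet.univ,
      Measure.restrict_univ]
  rw [hZ, integral_eq_lintegral_of_nonneg_ae (ae_of_all _ fun U => (Real.exp_pos _).le)]
  exact (Real.measurable_exp.comp
    ((WilsonRP.measurable_wilsonAction ρ hρ).const_mul _)).aestronglyMeasurable

/-- `0 < ∫ e^{-β S} dHaar^{⊗E}` (the integrand is bounded below by `e^{-|β| B}`). [folklore] -/
theorem integral_exp_neg_mul_wilsonAction_pos [NeZero L] (hρ : Continuous ρ) (β : ℝ) :
    0 < ∫ U, Real.exp (-β * wilsonAction ρ U) ∂(Measure.pi fun _ : Edge d L => haarProbability G) := by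
  obtain ⟨B, hB⟩ := exists_abs_wilsonAction_le (d := d) (L := L) ρ hρ
  have hle : ∀ U : GaugeConfig d L G, Real.exp (-(|β| * B)) ≤ Real.exp (-β * wilsonAction ρ U) :=
    fun U => Real.exp_le_exp.2 (by
      have h1 : |β * wilsonAction ρ U| ≤ |β| * B := by
        rw [abs_mul]; exact mul_le_mul_of_nonneg_left (hB U) (abs_nonneg _)
      have := (abs_le.1 h1).2
      linarith)
  calc (0 : ℝ) < Real.exp (-(|β| * B)) := Real.exp_pos _
    _ = ∫ _U, Real.exp (-(|β| * B)) ∂(Measure.pi fun _ : Edge d L => haarProbability G) := by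
        rw [integral_const, probReal_univ, one_smul]
    _ ≤ ∫ U, Real.exp (-β * wilsonAction ρ U) ∂(Measure.pi fun _ : Edge d L => haarProbability G) :=
        integral_mono (integrable_const _) (integrable_exp_mul_wilsonAction ρ hρ (-β) _) hle

/-- `log Z_{Λ,β} = log ∫ e^{-β S} dHaar^{⊗E}`. [folklore] -/
theorem torusLogPartition_eq_log_integral [NeZero L] (hρ : Continuous ρ) (β : ℝ) :
    torusLogPartition d ρ β L =
      Real.log (∫ U, Real.exp (-β * wilsonAction ρ U)
        ∂(Measure.pi fun _ : Edge d L => haarProbability G)) := by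
  rw [torusLogPartition, partitionFunction_toReal_eq_integral ρ hρ β]

/-- **Wilson expectations as Gibbs averages against product Haar measure**,
`⟨X⟩_{Λ,β} = ∫ X e^{-βS} dHaar^{⊗E} / ∫ e^{-βS} dHaar^{⊗E}`, for every compact `G` and continuous
`ρ` (no countability assumption), every dimension and torus size. [folklore] -/
theorem wilsonExpectation_eq_integral_div [NeZero L] (hρ : Continuous ρ) (β : ℝ)
    (X : GaugeConfig d L G → ℝ) :
    wilsonExpectation ρ β X =
      (∫ U, X U * Real.exp (-β * wilsonAction ρ U)
          ∂(Measure.pi fun _ : Edge d L => haarProbability G)) /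
        ∫ U, Real.exp (-β * wilsonAction ρ U) ∂(Measure.pi fun _ : Edge d L => haarProbability G) := by
  have hw : Measurable fun U : GaugeConfig d L G =>
      ENNReal.ofReal (Real.exp (-β * wilsonAction ρ U)) :=
    (Real.measurable_exp.comp ((WilsonRP.measurable_wilsonAction ρ hρ).const_mul _)).ennreal_ofReal
  unfold wilsonExpectation wilsonMeasure
  rw [integral_smul_measure, wilsonWeight, integral_withDensity_eq_integral_toReal_smul hw
    (ae_of_all _ fun _ => ENNReal.ofReal_lt_top), ENNReal.toReal_inv,
    partitionFunction_toReal_eq_integral ρ hρ β, smul_eq_mul, inv_mul_eq_div]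
  congr 1
  refine integral_congr_ae (ae_of_all _ fun U => ?_)
  beta_reduce
  rw [ENNReal.toReal_ofReal (Real.exp_pos _).le, smul_eq_mul, mul_comm]

/-! ### The Gibbs–Jensen inequality, monotonicity of `⟨S⟩_β`, convexity of `log Z` -/

/-- **Supporting-line (Gibbs–Jensen) inequality for the torus free energy.** For all real `β, β'`,
`(β - β') ⟨S⟩_{Λ,β} ≤ log Z_{Λ,β'} - log Z_{Λ,β}`: indeed `Z(β')/Z(β) = ⟨e^{(β-β')S}⟩_β ≥
e^{(β-β')⟨S⟩_β}` by Jensen. Equivalently, `-⟨S⟩_β` is a subgradient of the convex function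
`log Z` at `β`. [folklore] -/
theorem mul_wilsonExpectation_wilsonAction_le [NeZero L] (hρ : Continuous ρ) (β β' : ℝ) :
    (β - β') * wilsonExpectation ρ β (wilsonAction (d := d) (L := L) (G := G) ρ) ≤
      torusLogPartition d ρ β' L - torusLogPartition d ρ β L := by
  haveI := isProbabilityMeasure_wilsonMeasure (d := d) (L := L) (G := G) ρ hρ β
  set π₀ : Measure (GaugeConfig d L G) := Measure.pi fun _ : Edge d L => haarProbability G with hπ₀
  set Z : ℝ → ℝ := fun b => ∫ U, Real.exp (-b * wilsonAction ρ U) ∂π₀ with hZ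
  have hZpos : ∀ b, 0 < Z b := fun b => integral_exp_neg_mul_wilsonAction_pos ρ hρ b
  -- Jensen for `exp` under the Wilson measure at `β`
  have hJ : Real.exp (∫ U, (β - β') * wilsonAction ρ U ∂(wilsonMeasure (d := d) (L := L) ρ β)) ≤
      ∫ U, Real.exp ((β - β') * wilsonAction ρ U) ∂(wilsonMeasure (d := d) (L := L) ρ β) :=
    (convexOn_exp.map_integral_le Real.continuous_exp.continuousOn isClosed_univ
      (ae_of_all _ fun _ => Set.mem_univ _) ((integrable_wilsonAction ρ hρ _).const_mul _)
      (integrable_exp_mul_wilsonAction ρ hρ (β - β') _))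
  -- the right-hand side is `Z(β')/Z(β)`
  have hR : ∫ U, Real.exp ((β - β') * wilsonAction ρ U) ∂(wilsonMeasure (d := d) (L := L) ρ β) =
      Z β' / Z β := by
    have h := wilsonExpectation_eq_integral_div (d := d) (L := L) ρ hρ β
      (fun U => Real.exp ((β - β') * wilsonAction ρ U))
    unfold wilsonExpectation at h
    rw [h]
    congr 1
    refine integral_congr_ae (ae_of_all _ fun U => ?_)
    beta_reduce
    rw [← Real.exp_add]
    congr 1
    ring
  rw [integral_const_mul, hR] at hJ
  have hlog := (Real.le_log_iff_exp_le (div_pos (hZpos β') (hZpos β))).2 hJ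
  rw [Real.log_div (hZpos β').ne' (hZpos β).ne'] at hlog
  unfold wilsonExpectation
  rw [torusLogPartition_eq_log_integral ρ hρ, torusLogPartition_eq_log_integral ρ hρ]
  exact hlog

/-- **The mean Wilson action is non-increasing in `β`**: `β' ≤ β ⟹ ⟨S⟩_{Λ,β} ≤ ⟨S⟩_{Λ,β'}`
(sum of the two supporting-line inequalities). [folklore] -/
theorem wilsonExpectation_wilsonAction_antitone [NeZero L] (hρ : Continuous ρ) :
    Antitone fun β : ℝ => wilsonExpectation ρ β (wilsonAction (d := d) (L := L) (G := G) ρ) := by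
  intro β' β hle
  rcases hle.lt_or_eq with hlt | heq
  · have h1 := mul_wilsonExpectation_wilsonAction_le (d := d) (L := L) ρ hρ β β'
    have h2 := mul_wilsonExpectation_wilsonAction_le (d := d) (L := L) ρ hρ β' β
    have hpos : 0 < β - β' := sub_pos.2 hlt
    have h3 : (β - β') * wilsonExpectation ρ β (wilsonAction (d := d) (L := L) (G := G) ρ) ≤
        (β - β') * wilsonExpectation ρ β' (wilsonAction (d := d) (L := L) (G := G) ρ) := by
      linarith
    exact le_of_mul_le_mul_left h3 hpos
  · subst heq
    exact le_rfl

/-- **Convexity of the torus free energy**: `β ↦ log Z_{Λ,β}` is convex on `ℝ` (it has the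
supporting line of slope `-⟨S⟩_β` at every `β`). [folklore] -/
theorem convexOn_torusLogPartition [NeZero L] (hρ : Continuous ρ) :
    ConvexOn ℝ Set.univ fun β : ℝ => torusLogPartition d ρ β L := by
  refine ⟨convex_univ, fun β₁ _ β₂ _ a b ha hb hab => ?_⟩
  obtain rfl : b = 1 - a := by linarith
  simp only [smul_eq_mul]
  set β : ℝ := a * β₁ + (1 - a) * β₂ with hβ
  have h1 := mul_wilsonExpectation_wilsonAction_le (d := d) (L := L) ρ hρ β β₁
  have h2 := mul_wilsonExpectation_wilsonAction_le (d := d) (L := L) ρ hρ β β₂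
  set E : ℝ := wilsonExpectation ρ β (wilsonAction (d := d) (L := L) (G := G) ρ) with hE
  have h1' := mul_le_mul_of_nonneg_left h1 ha
  have h2' := mul_le_mul_of_nonneg_left h2 hb
  have hsum : a * ((β - β₁) * E) + (1 - a) * ((β - β₂) * E) = 0 := by
    rw [hβ]; ring
  linarith

/-! ### The weak-coupling (Laplace) bound on the mean action -/

omit [TopologicalSpace G] [IsTopologicalGroup G] [CompactSpace G] [MeasurableSpace G]
  [BorelSpace G] in
/-- The Wilson action is non-negative when `Re tr ρ ≤ N` (e.g. `ρ` unitary). [folklore] -/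
theorem wilsonAction_nonneg_of_re_trace_le [NeZero L] (hρN : ∀ g, (ρ g).trace.re ≤ N)
    (U : GaugeConfig d L G) : 0 ≤ wilsonAction ρ U :=
  Finset.sum_nonneg fun _ _ => sub_nonneg.2 (hρN _)

omit [TopologicalSpace G] [IsTopologicalGroup G] [CompactSpace G] [MeasurableSpace G]
  [BorelSpace G] in
/-- The trivial configuration has zero Wilson action. [folklore] -/
theorem wilsonAction_one_eq_zero [NeZero L] :
    wilsonAction ρ (1 : GaugeConfig d L G) = 0 := by
  unfold wilsonAction
  refine Finset.sum_eq_zero fun p _ => ?_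
  simp [plaquetteHolonomy, Matrix.trace_one]

omit [CompactSpace G] [MeasurableSpace G] [BorelSpace G] in
/-- The Wilson action is continuous (continuous `ρ`). [folklore] -/
theorem continuous_wilsonAction_of_continuous [NeZero L] (hρ : Continuous ρ) :
    Continuous (wilsonAction (d := d) (L := L) (G := G) ρ) := by
  unfold wilsonAction
  refine continuous_finsetSum _ fun p _ => ?_
  have h1 : Continuous fun U : GaugeConfig d L G => plaquetteHolonomy U p.1 p.2.1.1 p.2.1.2 := by
    unfold plaquetteHolonomy; fun_prop
  exact continuous_const.sub (Complex.continuous_re.comp (hρ.comp h1).matrix_trace)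

/-- **The small-ball function of the action is positive**: `Haar^{⊗E}{S ≤ ε} > 0` for `ε > 0`
(`{S < ε}` is an open neighbourhood of the trivial configuration and product Haar measure charges
open sets). [folklore] -/
theorem measureReal_wilsonAction_le_pos [NeZero L] (hρ : Continuous ρ) {ε : ℝ} (hε : 0 < ε) :
    0 < (Measure.pi fun _ : Edge d L => haarProbability G).real
      {U : GaugeConfig d L G | wilsonAction ρ U ≤ ε} := by
  haveI : (haarProbability G).IsOpenPosMeasure := by unfold haarProbability; infer_instance
  have hopen : IsOpen {U : GaugeConfig d L G | wilsonAction ρ U < ε} :=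
    isOpen_lt (continuous_wilsonAction_of_continuous ρ hρ) continuous_const
  have hne : ({U : GaugeConfig d L G | wilsonAction ρ U < ε}).Nonempty :=
    ⟨1, by simpa [wilsonAction_one_eq_zero] using hε⟩
  have hpos := hopen.measure_pos (Measure.pi fun _ : Edge d L => haarProbability G) hne
  have hsub : {U : GaugeConfig d L G | wilsonAction ρ U < ε} ⊆ {U | wilsonAction ρ U ≤ ε} :=
    fun U (hU : wilsonAction ρ U < ε) => show wilsonAction ρ U ≤ ε from le_of_lt hU
  exact ENNReal.toReal_pos (ne_of_gt (hpos.trans_le (measure_mono hsub))) (measure_ne_top _ _)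

/-- **Laplace lower bound for the partition function**: for `β ≥ 0`,
`e^{-βε} · Haar^{⊗E}{S ≤ ε} ≤ ∫ e^{-βS} dHaar^{⊗E} = Z_{Λ,β}`. [folklore] -/
theorem exp_mul_measureReal_le_integral_exp [NeZero L] (hρ : Continuous ρ) {β : ℝ} (hβ : 0 ≤ β)
    (ε : ℝ) :
    Real.exp (-β * ε) * (Measure.pi fun _ : Edge d L => haarProbability G).real
        {U : GaugeConfig d L G | wilsonAction ρ U ≤ ε} ≤
      ∫ U, Real.exp (-β * wilsonAction ρ U) ∂(Measure.pi fun _ : Edge d L => haarProbability G) := by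
  set π₀ : Measure (GaugeConfig d L G) := Measure.pi fun _ : Edge d L => haarProbability G with hπ₀
  set A : Set (GaugeConfig d L G) := {U | wilsonAction ρ U ≤ ε} with hA
  have hAm : MeasurableSet A := measurableSet_le (WilsonRP.measurable_wilsonAction ρ hρ) measurable_const
  have hind : ∫ U, A.indicator (fun _ => Real.exp (-β * ε)) U ∂π₀ = Real.exp (-β * ε) * π₀.real A := by
    rw [integral_indicator_const _ hAm, smul_eq_mul, mul_comm]
  rw [← hind]
  refine integral_mono ((integrable_const _).indicator hAm)
    (integrable_exp_mul_wilsonAction ρ hρ (-β) _) fun U => ?_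
  by_cases hU : U ∈ A
  · rw [Set.indicator_of_mem hU]
    refine Real.exp_le_exp.2 ?_
    have hU' : wilsonAction ρ U ≤ ε := hU
    nlinarith
  · rw [Set.indicator_of_notMem hU]
    exact (Real.exp_pos _).le

/-- **Weak-coupling (Laplace) bound on the mean action.** If `Re tr ρ ≤ N` (so `S ≥ 0`), then for
`β > 0` and every `ε > 0`,
`⟨S⟩_{Λ,β} ≤ 2ε - (2/β) · log Haar^{⊗E}{S ≤ ε}`:
the supporting-line inequality at `(β, β/2)` gives `(β/2)⟨S⟩_β ≤ log Z(β/2) - log Z(β)`, and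
`Z(β/2) ≤ 1`, `Z(β) ≥ e^{-βε} Haar^{⊗E}{S ≤ ε}`. With a polynomial small-ball bound
`Haar^{⊗E}{S ≤ ε} ≥ c ε^k` and `ε = 1/β` this reads `⟨S⟩_β ≤ (2 + 2k log β - 2 log c)/β`. [folklore] -/
theorem wilsonExpectation_wilsonAction_le_laplace [NeZero L] (hρ : Continuous ρ)
    (hρN : ∀ g, (ρ g).trace.re ≤ N) {β ε : ℝ} (hβ : 0 < β) (hε : 0 < ε) :
    wilsonExpectation ρ β (wilsonAction (d := d) (L := L) (G := G) ρ) ≤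
      2 * ε - (2 / β) * Real.log ((Measure.pi fun _ : Edge d L => haarProbability G).real
        {U : GaugeConfig d L G | wilsonAction ρ U ≤ ε}) := by
  set π₀ : Measure (GaugeConfig d L G) := Measure.pi fun _ : Edge d L => haarProbability G with hπ₀
  set p : ℝ := π₀.real {U : GaugeConfig d L G | wilsonAction ρ U ≤ ε} with hp
  have hppos : 0 < p := measureReal_wilsonAction_le_pos ρ hρ hε
  set Z : ℝ → ℝ := fun b => ∫ U, Real.exp (-b * wilsonAction ρ U) ∂π₀ with hZ
  have hZpos : ∀ b, 0 < Z b := fun b => integral_exp_neg_mul_wilsonAction_pos ρ hρ b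
  -- `Z(β/2) ≤ 1`
  have hZhalf : Z (β / 2) ≤ 1 := by
    calc Z (β / 2) ≤ ∫ _U, (1 : ℝ) ∂π₀ := by
          refine integral_mono (integrable_exp_mul_wilsonAction ρ hρ _ _) (integrable_const _)
            fun U => ?_
          have h0 := wilsonAction_nonneg_of_re_trace_le ρ hρN U
          have : -(β / 2) * wilsonAction ρ U ≤ 0 := by nlinarith
          simpa using Real.exp_le_one_iff.2 this
      _ = 1 := by rw [integral_const, probReal_univ, one_smul]
  -- `Z(β) ≥ e^{-βε} p`
  have hZβ : Real.exp (-β * ε) * p ≤ Z β := exp_mul_measureReal_le_integral_exp ρ hρ hβ.le ε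
  have hmain := mul_wilsonExpectation_wilsonAction_le (d := d) (L := L) ρ hρ β (β / 2)
  rw [torusLogPartition_eq_log_integral ρ hρ, torusLogPartition_eq_log_integral ρ hρ] at hmain
  have hlog1 : Real.log (Z (β / 2)) ≤ 0 := Real.log_nonpos (hZpos _).le hZhalf
  have hlog2 : -β * ε + Real.log p ≤ Real.log (Z β) := by
    have h := Real.log_le_log (mul_pos (Real.exp_pos _) hppos) hZβ
    rwa [Real.log_mul (Real.exp_pos _).ne' hppos.ne', Real.log_exp] at h
  set E : ℝ := wilsonExpectation ρ β (wilsonAction (d := d) (L := L) (G := G) ρ) with hE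
  have h1 : (β - β / 2) * E ≤ β * ε - Real.log p := by
    change (β - β / 2) * E ≤ Real.log (Z (β / 2)) - Real.log (Z β) at hmain
    linarith
  have h2 : β * E ≤ β * (2 * ε - 2 / β * Real.log p) := by
    have : β * (2 * ε - 2 / β * Real.log p) = 2 * (β * ε - Real.log p) := by
      field_simp
    rw [this]
    linarith
  exact le_of_mul_le_mul_left h2 hβ

end Literature.MathematicalPhysics.QuantumFieldTheory

end
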